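import Summits.NavierStokesRegularity.NavierStokesRegularity.Theorems.ExtremiserTransienceNearExtremalTransienceExtremiserLiouvilleConstantSpeedMultiplierIdentities
import Summits.NavierStokesRegularity.NavierStokesRegularity.Theorems.ExtremiserTransienceKStarAttainedEulerLagrange
import Literature.Analysis.FluidPDE.VorticityStretching
import HarnessLib

/-!
# Crux `ExtremiserTransience.NearExtremalTransience` (stmt-NavierStokesRegularity-21883), line `extremiser_liouville`,
# stub K1b — THE HELICITY LAW OF THE KKT MULTIPLIER (`⟪v, ω⟫ μ = ⟪G, v⟫ dx`, pointwise sign law)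

`--supports stmt-NavierStokesRegularity-21883` (helper).  Author: prover seat `ns-el-k1b` (g3).

Setting: the K1b residue object `v` (constant speed `‖v‖ ≡ M > 0`, extended extremiser) with its KKT multiplier measure
`μ` (`…ConstantSpeedMultiplierMeasure.exists_multiplierMeasure`: `ℓ(φ) = ∫⟪v, φ⟫dμ` for all solenoidal test fields)
and the continuous Euler–Lagrange DENSITY `G` of the first variation on curls
(`…KStarAttainedEulerLagrange.density_formula`: `ℓ(curl η) = ∫⟪G, η⟫` for all `η ∈ C_c^∞`, with the explicit
`G = S·(curl curl (Dv ω) − curl (Dω ω) + curl curl (Dvᵀω)) − κ⋆²M²W·curl curl ω + κ⋆²M²Z·curl curl Δω`).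

* `multiplier_curl_identity` : **`∫ ⟪G, η⟫ dx = ∫ ⟪v, curl η⟫ dμ` for every `η ∈ C_c^∞(ℝ³; ℝ³)`** — the
  Euler–Lagrange equation WITH MEASURE MULTIPLIER in curl form: `G dx = curl (v μ)` in `𝒟'` (every curl is a
  solenoidal test field).
* `inner_self_curl_smul` : `⟪v, curl (ψ v)⟫ = ψ ⟪v, curl v⟫` (`v · (∇ψ × v) = 0`), whence, testing with `η = ψ v`:
* `multiplier_helicity_identity` : **`∫ ψ ⟪G, v⟫ dx = ∫ ψ ⟪v, curl v⟫ dμ` for every `ψ ∈ C_c^∞(ℝ³)`** — the signed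
  measure `h μ` (`h = ⟪v, curl v⟫` the helicity density / TWIST of the unit field) is absolutely continuous with the
  ANALYTIC density `⟪G, v⟫`; on `{h ≠ 0}` the multiplier is the function `⟪G, v⟫/h`.
* `helicity_mul_inner_density_nonneg` : since `μ ≥ 0`, **`⟪v x, curl v x⟫ · ⟪G x, v x⟫ ≥ 0` at EVERY point** — a
  pointwise sign law between two explicit differential expressions of the residue object (orders 1 and 5);
  `inner_density_eq_zero_of_helicity_eq_zero` : a TWIST-FREE residue object (`⟪v, curl v⟫ ≡ 0`) has `⟪G, v⟫ ≡ 0`.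
* `residue_helicity_sign_law` : the sign law for the residue object with the explicit `G`, all inputs discharged
  (`exists_multiplierMeasure`, `density_formula`).

WHAT THIS IS NOT: necessary conditions on the HYPOTHETICAL K1b residue object; K1b is NOT proved; nothing here
proves NS regularity. [folklore]
-/

noncomputable section

open Set Filter Topology MeasureTheory Metric Function
open scoped ENNReal NNReal Topology InnerProductSpace RealInnerProductSpace ContDiff Laplacian
open Literature.Analysis.FluidPDE Literature.Analysis

namespace Summit.NavierStokesRegularity.NavierStokesRegularity.Theorems

-- the problem directory repeats the summit name (`NavierStokesRegularity/NavierStokesRegularity`)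
set_option linter.dupNamespace false

namespace ExtremiserLiouville

open DepletionLadder.KStar DepletionLadder.KStar.HalfSpace

variable {v G : E3 → E3} {M : ℝ} {μ : Measure E3}

/-! ## Pointwise algebra: `v · curl (ψ v) = ψ (v · curl v)` -/

/-- `⟪a, curlCLM (ℓ ⊗ a)⟫ = 0`: the curl of the rank-one Jacobian `h ↦ ℓ(h) a` is `∇ℓ × a ⊥ a`. [folklore] -/
theorem inner_self_curlCLM_smulRight (ℓ : E3 →L[ℝ] ℝ) (a : E3) : ⟪a, curlCLM (ℓ.smulRight a)⟫_ℝ = 0 := by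
  rw [curlCLM_apply]
  simp only [PiLp.inner_apply, RCLike.inner_apply, conj_trivial, Fin.sum_univ_three,
    ContinuousLinearMap.smulRight_apply, PiLp.smul_apply, smul_eq_mul, Matrix.cons_val_zero, Matrix.cons_val_one,
    Matrix.cons_val_two, Matrix.head_cons, Matrix.tail_cons]
  ring

/-- **`⟪v, curl (ψ v)⟫ = ψ ⟪v, curl v⟫`** at a point where `ψ` and `v` are differentiable (Leibniz `curl_smul`;
the `∇ψ × v` part is orthogonal to `v`). [folklore] -/
theorem inner_self_curl_smul {ψ : E3 → ℝ} {x : E3} (hψ : DifferentiableAt ℝ ψ x) (hv : DifferentiableAt ℝ v x) :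
    ⟪v x, curl (fun y => ψ y • v y) x⟫_ℝ = ψ x * ⟪v x, curl v x⟫_ℝ := by
  rw [curl_smul hψ hv, inner_add_right, real_inner_smul_right, inner_self_curlCLM_smulRight, add_zero]

/-! ## The Euler–Lagrange equation with measure multiplier, in curl form -/

/-- **`∫ ⟪G, η⟫ dx = ∫ ⟪v, curl η⟫ dμ` for all `η ∈ C_c^∞`**: if `G` is a density of the first variation on curls
(`ℓ(curl η) = ∫⟪G, η⟫`) and `μ` a multiplier (`ℓ(φ) = ∫⟪v, φ⟫dμ` on solenoidal test fields), then `G dx = curl(vμ)`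
distributionally. [folklore] -/
theorem multiplier_curl_identity
    (hG : ∀ η : E3 → E3, ContDiff ℝ ∞ η → HasCompactSupport η →
      Jst v * J1 v (curl η) - kStar ^ 2 * M ^ 2 * (Wpa v * A1 v (curl η) + Zen v * C1 v (curl η)) = ∫ x, ⟪G x, η x⟫_ℝ)
    (hμ : ∀ φ : E3 → E3, ContDiff ℝ ∞ φ → HasCompactSupport φ → VectorCalculus.IsDivFree φ →
      Jst v * J1 v φ - kStar ^ 2 * M ^ 2 * (Wpa v * A1 v φ + Zen v * C1 v φ) = ∫ x, ⟪v x, φ x⟫_ℝ ∂μ)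
    {η : E3 → E3} (hη : ContDiff ℝ ∞ η) (hηc : HasCompactSupport η) :
    ∫ x, ⟪G x, η x⟫_ℝ = ∫ x, ⟪v x, curl η x⟫_ℝ ∂μ := by
  rw [← hG η hη hηc]
  exact hμ (curl η) (contDiff_curl_top hη) (hasCompactSupport_curl hηc)
    fun x => divergence_curl_eq_zero_holds η (hη.of_le (by norm_cast)) x

/-- **THE HELICITY IDENTITY `h μ = ⟪G, v⟫ dx`**: `∫ ψ ⟪G, v⟫ dx = ∫ ψ ⟪v, curl v⟫ dμ` for every `ψ ∈ C_c^∞(ℝ³)`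
(test `multiplier_curl_identity` with `η = ψ v` and use `⟪v, curl(ψ v)⟫ = ψ⟪v, curl v⟫`). [folklore] -/
theorem multiplier_helicity_identity (hv : ContDiff ℝ ∞ v)
    (hG : ∀ η : E3 → E3, ContDiff ℝ ∞ η → HasCompactSupport η →
      Jst v * J1 v (curl η) - kStar ^ 2 * M ^ 2 * (Wpa v * A1 v (curl η) + Zen v * C1 v (curl η)) = ∫ x, ⟪G x, η x⟫_ℝ)
    (hμ : ∀ φ : E3 → E3, ContDiff ℝ ∞ φ → HasCompactSupport φ → VectorCalculus.IsDivFree φ →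
      Jst v * J1 v φ - kStar ^ 2 * M ^ 2 * (Wpa v * A1 v φ + Zen v * C1 v φ) = ∫ x, ⟪v x, φ x⟫_ℝ ∂μ)
    {ψ : E3 → ℝ} (hψ : ContDiff ℝ ∞ ψ) (hψc : HasCompactSupport ψ) :
    ∫ x, ψ x * ⟪G x, v x⟫_ℝ = ∫ x, ψ x * ⟪v x, curl v x⟫_ℝ ∂μ := by
  have hη : ContDiff ℝ ∞ fun y => ψ y • v y := hψ.smul hv
  have hηc : HasCompactSupport fun y => ψ y • v y := hψc.smul_right
  have h := multiplier_curl_identity hG hμ hη hηc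
  have hvd : Differentiable ℝ v := hv.differentiable (by simp)
  have hψd : Differentiable ℝ ψ := hψ.differentiable (by simp)
  have h1 : ∀ x, ⟪G x, ψ x • v x⟫_ℝ = ψ x * ⟪G x, v x⟫_ℝ := fun x => real_inner_smul_right _ _ _
  have h2 : ∀ x, ⟪v x, curl (fun y => ψ y • v y) x⟫_ℝ = ψ x * ⟪v x, curl v x⟫_ℝ := fun x =>
    inner_self_curl_smul (hψd x) (hvd x)
  simp only [h1, h2] at h
  exact h

/-! ## The pointwise sign law -/

/-- **`⟪v x, curl v x⟫ · ⟪G x, v x⟫ ≥ 0` everywhere** (`μ ≥ 0`): if the product were negative at `x₀`, a bump `ψ ≥ 0`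
concentrated at `x₀` would give `∫ψ⟪G,v⟫dx` and `∫ψ⟪v, curl v⟫dμ` opposite strict signs. [folklore] -/
theorem helicity_mul_inner_density_nonneg (hv : ContDiff ℝ ∞ v) (hGc : Continuous G)
    (hG : ∀ η : E3 → E3, ContDiff ℝ ∞ η → HasCompactSupport η →
      Jst v * J1 v (curl η) - kStar ^ 2 * M ^ 2 * (Wpa v * A1 v (curl η) + Zen v * C1 v (curl η)) = ∫ x, ⟪G x, η x⟫_ℝ)
    (hμ : ∀ φ : E3 → E3, ContDiff ℝ ∞ φ → HasCompactSupport φ → VectorCalculus.IsDivFree φ →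
      Jst v * J1 v φ - kStar ^ 2 * M ^ 2 * (Wpa v * A1 v φ + Zen v * C1 v φ) = ∫ x, ⟪v x, φ x⟫_ℝ ∂μ)
    (x₀ : E3) : 0 ≤ ⟪v x₀, curl v x₀⟫_ℝ * ⟪G x₀, v x₀⟫_ℝ := by
  by_contra hneg
  rw [not_le] at hneg
  have hhc : Continuous fun x => ⟪v x, curl v x⟫_ℝ := hv.continuous.inner (contDiff_curl_top hv).continuous
  have hgc : Continuous fun x => ⟪G x, v x⟫_ℝ := hGc.inner hv.continuous
  -- a bump `b` at `x₀` supported where `h = ⟪v, curl v⟫` and `g = ⟪G, v⟫` keep their (opposite) signs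
  have key : ∀ {U : Set E3}, IsOpen U → x₀ ∈ U → ∃ b : ContDiffBump x₀, ∀ x, (b : E3 → ℝ) x ≠ 0 → x ∈ U := by
    intro U hU hx₀
    obtain ⟨r, hr, hball⟩ := Metric.isOpen_iff.1 hU x₀ hx₀
    refine ⟨⟨r / 2, r, half_pos hr, half_lt_self hr⟩, fun x hx => hball ?_⟩
    have hx' : x ∈ Function.support fun y => (⟨r / 2, r, half_pos hr, half_lt_self hr⟩ : ContDiffBump x₀) y := hx
    rwa [ContDiffBump.support_eq] at hx'
  rcases mul_neg_iff.1 hneg with ⟨hh0, hg0⟩ | ⟨hh0, hg0⟩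
  · -- `h x₀ > 0`, `g x₀ < 0`
    obtain ⟨b, hbU⟩ := key ((isOpen_lt continuous_const hhc).inter (isOpen_lt hgc continuous_const)) ⟨hh0, hg0⟩
    have hid := multiplier_helicity_identity hv hG hμ b.contDiff b.hasCompactSupport
    have hL : ∫ x, b x * ⟪G x, v x⟫_ℝ < 0 := by
      have hpos : 0 < ∫ x, -(b x * ⟪G x, v x⟫_ℝ) := by
        refine Continuous.integral_pos_of_hasCompactSupport_nonneg_nonzero (b.continuous.mul hgc).neg
          b.hasCompactSupport.mul_right.neg (fun x => ?_) (x := x₀) ?_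
        · show 0 ≤ -(b x * ⟪G x, v x⟫_ℝ)
          by_cases hx : (b : E3 → ℝ) x = 0
          · rw [hx, zero_mul, neg_zero]
          · exact neg_nonneg.2 (mul_nonpos_of_nonneg_of_nonpos b.nonneg (hbU x hx).2.le)
        · have hb1 : b x₀ = 1 := b.one_of_mem_closedBall (mem_closedBall_self b.rIn_pos.le)
          rw [hb1, one_mul, neg_ne_zero]
          exact hg0.ne
      rw [integral_neg] at hpos
      linarith
    have hR : 0 ≤ ∫ x, b x * ⟪v x, curl v x⟫_ℝ ∂μ := by
      refine integral_nonneg fun x => ?_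
      show 0 ≤ b x * ⟪v x, curl v x⟫_ℝ
      by_cases hx : (b : E3 → ℝ) x = 0
      · rw [hx, zero_mul]
      · exact mul_nonneg b.nonneg (hbU x hx).1.le
    rw [hid] at hL
    exact absurd hR (not_le.2 hL)
  · -- `h x₀ < 0`, `g x₀ > 0`
    obtain ⟨b, hbU⟩ := key ((isOpen_lt hhc continuous_const).inter (isOpen_lt continuous_const hgc)) ⟨hh0, hg0⟩
    have hid := multiplier_helicity_identity hv hG hμ b.contDiff b.hasCompactSupport
    have hL : 0 < ∫ x, b x * ⟪G x, v x⟫_ℝ := by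
      refine Continuous.integral_pos_of_hasCompactSupport_nonneg_nonzero (b.continuous.mul hgc)
        b.hasCompactSupport.mul_right (fun x => ?_) (x := x₀) ?_
      · show 0 ≤ b x * ⟪G x, v x⟫_ℝ
        by_cases hx : (b : E3 → ℝ) x = 0
        · rw [hx, zero_mul]
        · exact mul_nonneg b.nonneg (hbU x hx).2.le
      · have hb1 : b x₀ = 1 := b.one_of_mem_closedBall (mem_closedBall_self b.rIn_pos.le)
        rw [hb1, one_mul]
        exact hg0.ne'
    have hR : ∫ x, b x * ⟪v x, curl v x⟫_ℝ ∂μ ≤ 0 := by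
      refine integral_nonpos fun x => ?_
      show b x * ⟪v x, curl v x⟫_ℝ ≤ 0
      by_cases hx : (b : E3 → ℝ) x = 0
      · rw [hx, zero_mul]
      · exact mul_nonpos_of_nonneg_of_nonpos b.nonneg (hbU x hx).1.le
    rw [hid] at hL
    exact absurd hR (not_le.2 hL)

/-- **A twist-free residue object has `⟪G, v⟫ ≡ 0`**: if `⟪v, curl v⟫ ≡ 0` then `∫ψ⟪G, v⟫ = 0` for all test `ψ`,
hence the continuous `⟪G, v⟫` vanishes identically. [folklore] -/
theorem inner_density_eq_zero_of_helicity_eq_zero (hv : ContDiff ℝ ∞ v) (hGc : Continuous G)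
    (hG : ∀ η : E3 → E3, ContDiff ℝ ∞ η → HasCompactSupport η →
      Jst v * J1 v (curl η) - kStar ^ 2 * M ^ 2 * (Wpa v * A1 v (curl η) + Zen v * C1 v (curl η)) = ∫ x, ⟪G x, η x⟫_ℝ)
    (hμ : ∀ φ : E3 → E3, ContDiff ℝ ∞ φ → HasCompactSupport φ → VectorCalculus.IsDivFree φ →
      Jst v * J1 v φ - kStar ^ 2 * M ^ 2 * (Wpa v * A1 v φ + Zen v * C1 v φ) = ∫ x, ⟪v x, φ x⟫_ℝ ∂μ)
    (hzero : ∀ x, ⟪v x, curl v x⟫_ℝ = 0) (x : E3) : ⟪G x, v x⟫_ℝ = 0 := by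
  have hgc : Continuous fun x => ⟪G x, v x⟫_ℝ := hGc.inner hv.continuous
  have hae : ∀ᵐ y ∂(volume : Measure E3), y ∈ (univ : Set E3) → ⟪G y, v y⟫_ℝ = 0 := by
    refine isOpen_univ.ae_eq_zero_of_integral_contDiff_smul_eq_zero (hgc.locallyIntegrable.locallyIntegrableOn _)
      fun ψ hψ hψc _ => ?_
    have h := multiplier_helicity_identity hv hG hμ hψ hψc
    simp only [hzero, mul_zero, integral_zero] at h
    simpa [smul_eq_mul] using h
  have hEq : EqOn (fun y => ⟪G y, v y⟫_ℝ) 0 univ :=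
    Measure.eqOn_open_of_ae_eq ((ae_restrict_iff' isOpen_univ.measurableSet).2 hae) isOpen_univ
      hgc.continuousOn continuousOn_const
  exact hEq (mem_univ x)

/-! ## The sign law for the residue object, all inputs discharged -/

/-- **HELICITY SIGN LAW of the K1b residue object.**  For a constant-speed extended extremiser `v` (`‖v‖ ≡ M > 0`,
`‖Dv‖ ≤ B`, `D¹v, D²v ∈ L²`, `|S| = κ⋆M√Z√W`), at EVERY point
`⟪v, curl v⟫ · ⟪G, v⟫ ≥ 0` with the explicit Euler–Lagrange density
`G = S·(curl curl (Dv ω) − curl (Dω ω) + curl curl (Dvᵀω)) − κ⋆²M²W·curl curl ω + κ⋆²M²Z·curl curl Δω`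
(`ω = curl v`).  [folklore] -/
theorem residue_helicity_sign_law (hv : ContDiff ℝ ∞ v) (hdiv : VectorCalculus.IsDivFree v) {M B : ℝ}
    (hMpos : 0 < M) (hM : ∀ x, ‖v x‖ = M) (hB : ∀ x, ‖fderiv ℝ v x‖ ≤ B)
    (h1 : ∫⁻ x, ‖iteratedFDeriv ℝ 1 v x‖ₑ ^ 2 < ⊤) (h2 : ∫⁻ x, ‖iteratedFDeriv ℝ 2 v x‖ₑ ^ 2 < ⊤)
    (hatt : |Jst v| = kStar * M * Real.sqrt (Zen v) * Real.sqrt (Wpa v)) (x : E3) :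
    0 ≤ ⟪v x, curl v x⟫_ℝ *
      ⟪(Jst v • (curl (curl (fun y => fderiv ℝ v y (curl v y))) x - curl (fun y => fderiv ℝ (curl v) y (curl v y)) x +
          curl (curl (fun y => ∑ j, ⟪curl v y, fderiv ℝ v y (EuclideanSpace.basisFun (Fin 3) ℝ j)⟫_ℝ •
          EuclideanSpace.basisFun (Fin 3) ℝ j)) x) +
        (-(kStar ^ 2 * M ^ 2 * Wpa v)) • curl (curl (curl v)) x -
        (-(kStar ^ 2 * M ^ 2 * Zen v)) • curl (curl (Δ (curl v))) x), v x⟫_ℝ := by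
  obtain ⟨μ, hfin, -, hμ⟩ := exists_multiplierMeasure hv hdiv hMpos hM hB h1 h2 hatt
  refine helicity_mul_inner_density_nonneg (μ := μ) hv (continuous_density hv (Jst v) (-(kStar ^ 2 * M ^ 2 * Wpa v))
    (-(kStar ^ 2 * M ^ 2 * Zen v))) (fun η hη hηc => ?_) hμ x
  have h := density_formula hv (Jst v) (-(kStar ^ 2 * M ^ 2 * Wpa v)) (-(kStar ^ 2 * M ^ 2 * Zen v)) hη hηc
  rw [← h]
  show Jst v * J1 v (curl η) - kStar ^ 2 * M ^ 2 * (Wpa v * A1 v (curl η) + Zen v * C1 v (curl η)) =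
    Jst v * J1 v (curl η) + -(kStar ^ 2 * M ^ 2 * Wpa v) * A1 v (curl η) + -(kStar ^ 2 * M ^ 2 * Zen v) * C1 v (curl η)
  ring

end ExtremiserLiouville

end Summit.NavierStokesRegularity.NavierStokesRegularity.Theorems

end
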